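import Summits.QuantumFields.BalabanUV.Beta.GAN24.WilsonPairFormCharge

/-!
# `BalabanUV.Beta.GAN24.PairFormContourClimb` — binder row G-an2-4 ∕ (CONV-C), the (S) row of RULING R-gan24p1-g27-1 B (viii), road-P2's (W-γ) CHARGE TOWER
# (`W-GAMMA-TOWER-v0.md` (I5) «the potential CLIMBS as `m_{j+1} ∝ 𝒬_{Lc} m_j`»; p2 g41 `ChargeTowerClimb` §3: `m′ = (σ_{j+1}∕wVH_{j+2})·𝒬_{Lc} m`), PART C of leaf-02 g57:
# **THE STRAIGHT BLOCK CONTOUR SUM OF THE PAIR FORM OF TWO BLOCK-CONSTANT COORDINATE POTENTIALS IS `L^{d+1}` TIMES THE PAIR FORM OF THE DESCENDED COORDINATE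
# POTENTIALS ON THE COARSE LATTICE** — `𝒬_L (m[F₁∘⌊·_a∕L⌋, F₂∘⌊·_b∕L⌋]) κ y = L^{d+1}·m[F₁∘(·)_a, F₂∘(·)_b] κ y` for EVERY `F₁ F₂ : ℤ → ℝ`, every `a b` (`a = b` included):
# each straight `b`-contour from a point of block `y` crosses exactly ONE exit `b`-bond, the one leaving block `y`, where the fine pair form reads the coarse data
# (G-an2-4 formalisation swarm → CRUX TEAM (2), seat `b2b-balaban-gan24-formalise-leaf-02`, gen 57; W-4 (N2) to p2 g41, journal l.45735)

NOT IN PRINT; OUR BOOKKEEPING ([folklore] box ∕ contour arithmetic: PART A's `dz_coordPot`, core `Int` division lemmas; 0 `def`, 0 cited fact, 0 `def … : Prop`, 0 sorry).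
HONEST FRAMING (cell contract, verbatim): «discharging `BetaPertH` makes Bałaban's UV stability UNCONDITIONAL — a real constructive-QFT result; it is NOT the continuum limit and
NOT the Clay problem.»  HONEST DEPENDENCY (verbatim): «continuum YM on T⁴ ⇐ BetaPertH ∧ nine spine estimates (0/9 proved); BetaPertH ⇐ (D1) ∧ (D4) ∧ CAP+tail; G-an2-4 gates
asym, D1 and NE2/3/4.»

WHY.  PART A ∕ B (`WilsonPairFormCharge`, `SrecChargeBlockPotentials`) give (I3)_0: the class-𝒟 two-leg charge of the level-0 step table is `cE·(−¼)·d*d m` with the pair form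
`m = m[F₁∘⌊·_a∕L⌋, F₂∘⌊·_b∕L⌋]` of two BLOCK-CONSTANT coordinate potentials.  The tower's Ward step (leaf-06 `RelInvWardPairing.ward_pairing`, p2 `RelInvWardPairingStep` ∕
`ChargeTowerClimb` §3) converts the `ℋ`-column read of `Δ_j m` into the next level's `Δ_{j+1}` of `(σ∕wVH)·𝒬_{Lc} m` — so what the next level sees is the STRAIGHT BLOCK CONTOUR
SUM of the pair form.  This file computes it in closed form: it is the pair form, on the coarse lattice, of the coordinate potentials `F₁(y_a)`, `F₂(y_b)` themselves, times
`L^{d+1}`; single-coordinate but NOT block-constant there unless the `F_i` are themselves `L`-block-constant — which locates in one identity why road-P2's class for the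
EXACT part of the tower is `{1, exit^{Lc^m}}` (potentials block-constant at every depth) and not all of 𝒟.

WHAT (generic `d`, `1 ≤ L`; `e_κ` = `AffineAveraging.unitVec` in the contour, `B6BondElimination.unitVec` inside the pair form as in PART A).
* §1 `ediv_block` (`(L·q + t)∕L = q` for `0 ≤ t < L`), the contour coordinates `contourPt_apply ∕ contourPt_succ_apply`;
* §2 `sum_range_pairForm_blockPot_contour` — ONE straight `b`-contour from the point `L•y + v` (`v ∈ box`): the `L` terms of the fine pair form sum to
  `ΔF₂(y_b)·(F₁(y_a) + F₁((y+e_b)_a))` (only `s = L−1−v_b` survives);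
* §3 **`contourSum_pairForm_blockPot_dir`** (direction `b`: `= L^{d+1}·ΔF₂(y_b)·(F₁(y_a) + F₁((y+e_b)_a))`) and **`contourSum_pairForm_blockPot`** (every direction `κ`:
  `contourSum L (m[F₁∘⌊·_a∕L⌋, F₂∘⌊·_b∕L⌋]) κ y = L^{d+1}·(dz (F₂∘(·)_b) κ y·(F₁(y_a) + F₁((y+e_κ)_a)))` — the coarse pair form) and
  **`contourSum_pairForm_blockPot_pow`** (road-P2's class `exit^{L^m}`: the `F_i∘⌊·∕L^{k+1}⌋` pair form climbs to the `F_i∘⌊·∕L^k⌋` pair form, every `k`).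
Asserts NO value of any resolvent column; NOTHING of (W-γ) ∕ (INV) ∕ (S) ∕ (DL) discharged; NEVER «G-an2-4 closed» as (CONV-C); NOT D1, NOT `BetaPertH`, NOT continuum, NOT Clay.
2026-08-22; no existing file touched.
-/

noncomputable section

open Finset
open scoped BigOperators
open Literature.MathematicalPhysics.QuantumFieldTheory
open Literature.MathematicalPhysics.QuantumFieldTheory.Balaban1983to89
open Literature.MathematicalPhysics.QuantumFieldTheory.Balaban1983to89.Beta
open AffineAveraging (Form1 box toSite unitVec unitVec_apply dz contourSum)
open Summit.QuantumFields.BalabanUV.Beta.GAN24.WilsonPairFormCharge (dz_coordPot)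

namespace Summit.QuantumFields.BalabanUV.Beta.GAN24.PairFormContourClimb

variable {d : ℕ}

/-! ## §1 Box and contour arithmetic -/

/-- [folklore] Division by the block side inside a block: `(L·q + t)∕L = q` for `0 ≤ t < L`. -/
theorem ediv_block {L : ℕ} (hL : 1 ≤ L) (q t : ℤ) (h0 : 0 ≤ t) (h1 : t < (L : ℤ)) : ((L : ℤ) * q + t) / (L : ℤ) = q := by
  have hL0 : (L : ℤ) ≠ 0 := by exact_mod_cast (by omega : L ≠ 0)
  rw [show (L : ℤ) * q + t = t + (L : ℤ) * q by ring, Int.add_mul_ediv_left _ _ hL0, Int.ediv_eq_zero_of_lt h0 h1, zero_add]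

/-- [folklore] The coordinates of a contour point `L•y + v + s•e_b`: `(…)_c = L·y_c + v_c + [c = b]·s`. -/
theorem contourPt_apply (L : ℕ) (y : Fin (d + 1) → ℤ) (v : Fin (d + 1) → ℕ) (s : ℕ) (b c : Fin (d + 1)) :
    ((L : ℤ) • y + toSite v + (s : ℤ) • unitVec b) c = (L : ℤ) * y c + (v c : ℤ) + (if c = b then (s : ℤ) else 0) := by
  simp only [Pi.add_apply, Pi.smul_apply, smul_eq_mul, AffineAveraging.toSite, unitVec_apply, mul_ite, mul_one, mul_zero]

/-- [folklore] The same after one more `b`-step (the `B6BondElimination.unitVec` spelling of the pair form's shift): `(… + e_b)_c = L·y_c + v_c + [c = b]·(s + 1)`. -/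
theorem contourPt_succ_apply (L : ℕ) (y : Fin (d + 1) → ℤ) (v : Fin (d + 1) → ℕ) (s : ℕ) (b c : Fin (d + 1)) :
    ((L : ℤ) • y + toSite v + (s : ℤ) • unitVec b + B6BondElimination.unitVec b) c = (L : ℤ) * y c + (v c : ℤ) + (if c = b then (s : ℤ) + 1 else 0) := by
  rw [Pi.add_apply, contourPt_apply, B6BondElimination.unitVec_apply]
  split_ifs <;> ring

/-! ## §2 One straight contour -/

/-- NOT IN PRINT; OUR BOOKKEEPING.  **ONE STRAIGHT `b`-CONTOUR OF THE FINE PAIR FORM** (`1 ≤ L`, `v ∈ box`, base block `y`): along `z_s = L•y + v + s•e_b`, `s < L`, the terms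
`ΔG₂(z_b)·(G₁(z_a) + G₁((z+e_b)_a))` (`G_i = F_i∘⌊·∕L⌋`) vanish except at the exit bond `s = L−1−v_b`, where they read `ΔF₂(y_b)·(F₁(y_a) + F₁((y+e_b)_a))`. -/
theorem sum_range_pairForm_blockPot_contour {L : ℕ} (hL : 1 ≤ L) (F₁ F₂ : ℤ → ℝ) (a b : Fin (d + 1)) (y : Fin (d + 1) → ℤ)
    {v : Fin (d + 1) → ℕ} (hv : v ∈ box (d + 1) L) :
    ∑ s ∈ Finset.range L,
        (F₂ ((((L : ℤ) • y + toSite v + (s : ℤ) • unitVec b) b + 1) / (L : ℤ)) - F₂ ((((L : ℤ) • y + toSite v + (s : ℤ) • unitVec b) b) / (L : ℤ)))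
          * (F₁ ((((L : ℤ) • y + toSite v + (s : ℤ) • unitVec b) a) / (L : ℤ))
            + F₁ ((((L : ℤ) • y + toSite v + (s : ℤ) • unitVec b + B6BondElimination.unitVec b) a) / (L : ℤ)))
      = (F₂ (y b + 1) - F₂ (y b)) * (F₁ (y a) + F₁ ((y + B6BondElimination.unitVec b) a)) := by
  have hvb : v b < L := Finset.mem_range.1 (Fintype.mem_piFinset.1 hv b)
  have hva : v a < L := Finset.mem_range.1 (Fintype.mem_piFinset.1 hv a)
  simp only [contourPt_apply, contourPt_succ_apply, ite_true]
  rw [Finset.sum_eq_single_of_mem (L - 1 - v b) (Finset.mem_range.2 (by omega))]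
  · -- the exit bond
    have hs : (((L - 1 - v b : ℕ) : ℤ)) = (L : ℤ) - 1 - (v b : ℤ) := by omega
    rw [hs]
    have e1 : (L : ℤ) * y b + (v b : ℤ) + ((L : ℤ) - 1 - (v b : ℤ)) + 1 = (L : ℤ) * (y b + 1) + 0 := by ring
    have e2 : (L : ℤ) * y b + (v b : ℤ) + ((L : ℤ) - 1 - (v b : ℤ)) = (L : ℤ) * y b + ((L : ℤ) - 1) := by ring
    rw [e1, e2, ediv_block hL _ _ le_rfl (by exact_mod_cast hL), ediv_block hL _ _ (by omega) (by omega)]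
    by_cases hab : a = b
    · rw [hab, if_pos rfl, if_pos rfl, Pi.add_apply, B6BondElimination.unitVec_apply, if_pos rfl]
      have e3 : (L : ℤ) * y b + (v b : ℤ) + ((L : ℤ) - 1 - (v b : ℤ)) = (L : ℤ) * y b + ((L : ℤ) - 1) := by ring
      have e4 : (L : ℤ) * y b + (v b : ℤ) + ((L : ℤ) - 1 - (v b : ℤ) + 1) = (L : ℤ) * (y b + 1) + 0 := by ring
      rw [e3, e4, ediv_block hL _ _ (by omega) (by omega), ediv_block hL _ _ le_rfl (by exact_mod_cast hL)]
    · rw [if_neg hab, if_neg hab, add_zero, ediv_block hL _ _ (by omega) (by omega), Pi.add_apply, B6BondElimination.unitVec_apply,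
        if_neg hab, add_zero]
  · -- every other bond of the contour: both coarse labels of `z_b`, `z_b + 1` agree
    intro s hs hne
    have hsL : s < L := Finset.mem_range.1 hs
    have hq : ((L : ℤ) * y b + (v b : ℤ) + (s : ℤ) + 1) / (L : ℤ) = ((L : ℤ) * y b + (v b : ℤ) + (s : ℤ)) / (L : ℤ) := by
      by_cases hlt : (v b : ℤ) + (s : ℤ) < (L : ℤ) - 1
      · rw [show (L : ℤ) * y b + (v b : ℤ) + (s : ℤ) + 1 = (L : ℤ) * y b + ((v b : ℤ) + (s : ℤ) + 1) by ring,
          show (L : ℤ) * y b + (v b : ℤ) + (s : ℤ) = (L : ℤ) * y b + ((v b : ℤ) + (s : ℤ)) by ring,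
          ediv_block hL _ _ (by omega) (by omega), ediv_block hL _ _ (by omega) (by omega)]
      · have hge : (L : ℤ) ≤ (v b : ℤ) + (s : ℤ) := by omega
        rw [show (L : ℤ) * y b + (v b : ℤ) + (s : ℤ) + 1 = (L : ℤ) * (y b + 1) + ((v b : ℤ) + (s : ℤ) + 1 - (L : ℤ)) by ring,
          show (L : ℤ) * y b + (v b : ℤ) + (s : ℤ) = (L : ℤ) * (y b + 1) + ((v b : ℤ) + (s : ℤ) - (L : ℤ)) by ring,
          ediv_block hL _ _ (by omega) (by omega), ediv_block hL _ _ (by omega) (by omega)]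
    rw [hq, sub_self, zero_mul]

/-! ## §3 The block contour sum of the pair form -/

/-- NOT IN PRINT; OUR BOOKKEEPING.  **THE `b`-DIRECTION BLOCK CONTOUR SUM OF THE FINE PAIR FORM** (`1 ≤ L`, every `F₁ F₂ a b y`):
`contourSum L (m[F₁∘⌊·_a∕L⌋, F₂∘⌊·_b∕L⌋]) b y = L^{d+1}·ΔF₂(y_b)·(F₁(y_a) + F₁((y+e_b)_a))` — `L^{d+1}` contours, each reading the coarse datum at its one exit bond (§2). -/
theorem contourSum_pairForm_blockPot_dir {L : ℕ} (hL : 1 ≤ L) (F₁ F₂ : ℤ → ℝ) (a b : Fin (d + 1)) (y : Fin (d + 1) → ℤ) :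
    contourSum L (fun β z => dz (fun w : Fin (d + 1) → ℤ => F₂ (w b / (L : ℤ))) β z
        * (F₁ (z a / (L : ℤ)) + F₁ ((z + B6BondElimination.unitVec β) a / (L : ℤ)))) b y
      = (L : ℝ) ^ (d + 1) * ((F₂ (y b + 1) - F₂ (y b)) * (F₁ (y a) + F₁ ((y + B6BondElimination.unitVec b) a))) := by
  have hdz : ∀ z : Fin (d + 1) → ℤ, dz (fun w : Fin (d + 1) → ℤ => F₂ (w b / (L : ℤ))) b z = F₂ ((z b + 1) / (L : ℤ)) - F₂ (z b / (L : ℤ)) := fun z => by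
    have h := dz_coordPot (fun t => F₂ (t / (L : ℤ))) b b z
    rw [if_pos rfl] at h
    exact h
  -- `#box = L^{d+1}` (the count is leaf-09's `TransversalZeroMode.card_box_succ`; kept local to avoid the import)
  have hcard : (box (d + 1) L).card = L ^ (d + 1) := by
    simp [AffineAveraging.box, Fintype.card_piFinset, Finset.card_range, Finset.prod_const, Finset.card_univ, Fintype.card_fin]
  simp only [AffineAveraging.contourSum, hdz]
  rw [Finset.sum_congr rfl fun v hv => sum_range_pairForm_blockPot_contour hL F₁ F₂ a b y hv, Finset.sum_const, hcard, nsmul_eq_mul]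
  push_cast
  ring

/-- NOT IN PRINT; OUR BOOKKEEPING.  **THE PAIR FORM CLIMBS** (`1 ≤ L`, EVERY `F₁ F₂ : ℤ → ℝ`, every `a b κ y`): the straight block contour sum of the fine pair form of the
block-constant coordinate potentials `F₁∘⌊·_a∕L⌋`, `F₂∘⌊·_b∕L⌋` is `L^{d+1}` times the COARSE pair form of the coordinate potentials `F₁∘(·)_a`, `F₂∘(·)_b`:
`contourSum L (m[F₁∘⌊·_a∕L⌋, F₂∘⌊·_b∕L⌋]) κ y = L^{d+1}·(dz (F₂∘(·)_b) κ y·(F₁(y_a) + F₁((y+e_κ)_a)))` (directions `κ ≠ b`: both sides vanish). -/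
theorem contourSum_pairForm_blockPot {L : ℕ} (hL : 1 ≤ L) (F₁ F₂ : ℤ → ℝ) (a b κ : Fin (d + 1)) (y : Fin (d + 1) → ℤ) :
    contourSum L (fun β z => dz (fun w : Fin (d + 1) → ℤ => F₂ (w b / (L : ℤ))) β z
        * (F₁ (z a / (L : ℤ)) + F₁ ((z + B6BondElimination.unitVec β) a / (L : ℤ)))) κ y
      = (L : ℝ) ^ (d + 1) * (dz (fun w : Fin (d + 1) → ℤ => F₂ (w b)) κ y * (F₁ (y a) + F₁ ((y + B6BondElimination.unitVec κ) a))) := by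
  by_cases hκ : κ = b
  · rw [hκ, contourSum_pairForm_blockPot_dir hL F₁ F₂ a b y, dz_coordPot F₂ b b y, if_pos rfl]
  · have hdz : ∀ z : Fin (d + 1) → ℤ, dz (fun w : Fin (d + 1) → ℤ => F₂ (w b / (L : ℤ))) κ z = 0 := fun z => by
      have h := dz_coordPot (fun t => F₂ (t / (L : ℤ))) b κ z
      rw [if_neg hκ] at h
      exact h
    simp only [AffineAveraging.contourSum, hdz, zero_mul, Finset.sum_const_zero, dz_coordPot F₂ b κ y, if_neg hκ, mul_zero]

/-- NOT IN PRINT; OUR BOOKKEEPING.  **ROAD-P2's CLASS `exit^{L^m}`: DEEPER BLOCK POTENTIALS CLIMB ONE DEPTH** (`1 ≤ L`, every `k`, EVERY `F₁ F₂`): with the fine potentials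
`F_i∘⌊·∕L^{k+1}⌋` (constant on `L^{k+1}`-blocks) the straight `L`-block contour sum of the pair form is `L^{d+1}` times the pair form of `F_i∘⌊·∕L^k⌋` on the coarse lattice
(`⌊⌊t∕L⌋∕L^k⌋ = ⌊t∕L^{k+1}⌋`, `Int.ediv_ediv_of_nonneg`) — the `L^{k+1}`-face pair form climbs to the `L^k`-face pair form one level up; `k = 0` is `contourSum_pairForm_blockPot`. -/
theorem contourSum_pairForm_blockPot_pow {L : ℕ} (hL : 1 ≤ L) (F₁ F₂ : ℤ → ℝ) (k : ℕ) (a b κ : Fin (d + 1)) (y : Fin (d + 1) → ℤ) :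
    contourSum L (fun β z => dz (fun w : Fin (d + 1) → ℤ => F₂ (w b / (L : ℤ) ^ (k + 1))) β z
        * (F₁ (z a / (L : ℤ) ^ (k + 1)) + F₁ ((z + B6BondElimination.unitVec β) a / (L : ℤ) ^ (k + 1)))) κ y
      = (L : ℝ) ^ (d + 1) * (dz (fun w : Fin (d + 1) → ℤ => F₂ (w b / (L : ℤ) ^ k)) κ y
          * (F₁ (y a / (L : ℤ) ^ k) + F₁ ((y + B6BondElimination.unitVec κ) a / (L : ℤ) ^ k))) := by
  have hL0 : (0 : ℤ) ≤ (L : ℤ) := Int.natCast_nonneg L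
  have h := contourSum_pairForm_blockPot hL (fun t => F₁ (t / (L : ℤ) ^ k)) (fun t => F₂ (t / (L : ℤ) ^ k)) a b κ y
  simp only [Int.ediv_ediv_of_nonneg hL0, ← pow_succ'] at h
  exact h

end Summit.QuantumFields.BalabanUV.Beta.GAN24.PairFormContourClimb

end
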